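import Summits.Ventures.PercRepro.RankLevelSetBiIndepAvoidSkew
import Summits.Ventures.PercRepro.RankLevelSetBiIndepContainCum

/-! # RankLevelSetBiIndepCumLadder — THE CUMULATIVE LADDER ASSEMBLED: (CX*)-cum ON THE MINORS ⟹ (★★) ⟹ Mono, AND
THE TWO ENTRIES INTO THE CUMULATIVE HYPOTHESIS (night-1 g30; dossier §42.15–§42.16)

Compositions only. `MinorsContainSkewCum M` (every minor `N` of `M` satisfies the cumulative (CX*) on every contain-set:
`MinorPairSkew N X ∅ (#E(N) − 2#X − 1)`) gives **`biIndepMono_of_cum`**: the monotone form of the bi-independent profile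
of `M` (C-025 for `M`), through `biIndepPerElem_of_cum` and `biIndepMono_of_perElem`. Entries into the hypothesis:
**`biContainMono_of_minorPairSkew`** (the cumulative (CX*) contains (CX): `i = k − #X`, `j = k + 1 − #X`, `i + j ≤ #E − 2#X − 1`
iff `2(k+1) ≤ #E`), **`minorsContainSkewCum_of_forall_minor`** ((CX*) ∧ (CX) ∧ unimodality on every minor ⟹ the
cumulative hypothesis, through `minorPairSkew_contain_of_skew_mono_unimodal`) and **`biIndepMono_of_forall_minor`**
(the same three reflection-form properties on every minor ⟹ Mono). Nothing here asserts (CX*); every declaration has a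
docstring; imports: the cell's own modules and Mathlib only. Axioms: standard. -/

namespace PercRepro

open Set Matroid

variable {α : Type} (M : Matroid α) [M.Finite]

/-- **The cumulative (CX*) contains (CX)**: `BiContainMono M` from `MinorPairSkew M X ∅ (#E − 2#X − 1)` for every `X`. -/
theorem biContainMono_of_minorPairSkew
    (h : ∀ X ⊆ M.E, MinorPairSkew M X ∅ (M.E.ncard - 2 * X.ncard - 1)) : BiContainMono M := by
  intro X hX k hk
  rcases Nat.lt_or_ge k X.ncard with hkX | hkX
  · rw [biContainCount_eq_zero_of_lt_ncard M hkX]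
    exact Nat.zero_le _
  · rw [biContainCount_eq_minorPairCount M hX hkX, biContainCount_eq_minorPairCount M hX (by omega)]
    exact h X hX _ _ (by omega) (by omega)

/-- **Mono from the cumulative ladder**: the cumulative (CX*) on every minor gives the monotone form of the
bi-independent profile of `M`. -/
theorem biIndepMono_of_cum (h : MinorsContainSkewCum M) : BiIndepMono M :=
  biIndepMono_of_perElem M (biIndepPerElem_of_cum M h)

/-- **Entry into the cumulative hypothesis**: (CX*), (CX) and unimodality of the contain profiles on every minor of
`M` give `MinorsContainSkewCum M`. -/
theorem minorsContainSkewCum_of_forall_minor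
    (h : ∀ N : Matroid α, Matroid.IsMinor N M → BiContainSkew N ∧ BiContainMono N ∧ BiContainUnimodal N) :
    MinorsContainSkewCum M := by
  intro N hN
  haveI : N.Finite := ⟨M.ground_finite.subset hN.subset⟩
  obtain ⟨h1, h2, h3⟩ := h N hN
  exact minorPairSkew_contain_of_skew_mono_unimodal N h1 h2 h3

/-- **Mono from the three reflection-form properties of the minors**: (CX*), (CX) and unimodality of the contain
profiles on every minor of `M` give the monotone form of the bi-independent profile of `M`. -/
theorem biIndepMono_of_forall_minor
    (h : ∀ N : Matroid α, Matroid.IsMinor N M → BiContainSkew N ∧ BiContainMono N ∧ BiContainUnimodal N) :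
    BiIndepMono M :=
  biIndepMono_of_cum M (minorsContainSkewCum_of_forall_minor M h)

end PercRepro
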